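import Summits.CriticalPhenomena.PercolationContinuityZ3.Theorems.PercNearOneGluingNoHeavyLowerTailCILReduction
import HarnessLib

/-!
# `NoHeavyLowerTail` (stmt-CriticalPhenomena-4575) — the GUARDED cumulative isolation lemma closes the crux

Lead of the crux (gen 2), 2026-08-18.  Bond percolation `μ = prodBernoulli w` on `Fin n`, relays `A`, observer
`o ∉ A`, level `j`, `π(v) = C(v) ∩ A`, `N = |π(o)|`.  The registered stub `stub_cumulativeIsolation` (CIL:
`∃ a ∈ A, P(1 ≤ N ≤ j) ≤ P(|π(a)| ≤ j)`) closes the crux (`Theorems.noHeavyLowerTail_of_stub_cumulativeIsolation`).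

Write `Big(v)` for the GUARD "some open cluster OTHER than `C(v)` holds more than `j` relays":
`Big(v) = {ω | ∃ b ∈ A, ω ∉ {v ↔ b} ∧ j < |π(b)|}` (at the crux level `j = ⌊|A|/2⌋` this says: the giant block
exists and `v` is not in it).  The GUARDED CUMULATIVE ISOLATION LEMMA at level `j` is

  `GCIL_j :  ∃ a ∈ A,  P(1 ≤ N ≤ j, Big(o)) ≤ P(|π(a)| ≤ j, Big(a))`

("the probability of sitting in a small nonempty relay block while a big block exists elsewhere is
maximised, over all vertices, at a relay").  Level `j = 1` is the guarded lonely relay lemma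
(`Theorems.guardedLonelyRelay`, guards "a big block among the other relays"), and `|A| = 4, j = 2` is the
mechanism of `…CILFour`; the general level is open (0 violations in exact enumeration; lead memo LEAD-GEN2.md).

This file PROVES that the guarded lemma implies the unguarded one WITH THE SAME WITNESS, hence the crux:

* `GuardedCIL.small_diff_subset` — `{1 ≤ N ≤ j} ∖ Big(o) ⊆ {|π(a)| ≤ j} ∖ Big(a)` for every relay `a`
  (if no cluster other than `C(o)` is big and `C(o)` holds `≤ j` relays, then every relay block is small
  and no cluster other than `C(a)` is big);
* `cumulativeIsolation_of_guardedCIL` — GCIL (all levels) ⇒ the hypothesis of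
  `noHeavyLowerTail_of_stub_cumulativeIsolation` (all levels);
* `noHeavyLowerTail_of_guardedCIL` — GCIL ⇒ `NoHeavyLowerTail`.
-/

noncomputable section

namespace Summit.CriticalPhenomena.PercolationContinuityZ3.Theorems

open MeasureTheory Set Literature.Probability.LatticeModels Literature.Probability.Percolation
open scoped Classical BigOperators

variable {n : ℕ}

namespace GuardedCIL

/-- If `o ↔ a` then the relays joined to `a` are exactly the relays joined to `o`. [folklore] -/
theorem filter_eq_of_reachable (A : Finset (Fin n)) {ω : BondConfig (Fin n)} {o a : Fin n}
    (h : ω ∈ openConn o a) :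
    (A.filter fun z => ω ∈ openConn a z) = (A.filter fun z => ω ∈ openConn o z) := by
  have h' : (openGraph ω).Reachable o a := h
  ext z
  simp only [Finset.mem_filter, and_congr_right_iff]
  intro _
  change (openGraph ω).Reachable a z ↔ (openGraph ω).Reachable o z
  exact ⟨fun hz => h'.trans hz, fun hz => h'.symm.trans hz⟩

/-- **The unguarded remainder is witness-independent.**  On `{1 ≤ N ≤ j}` minus the guard of `o`
(no cluster other than `C(o)` is big), every relay `a` has a small block and no big cluster other than
`C(a)`: `{1 ≤ N ≤ j} ∖ Big(o) ⊆ {|π(a)| ≤ j} ∖ Big(a)`. [folklore] -/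
theorem small_diff_subset (A : Finset (Fin n)) (o a : Fin n) (j : ℕ) :
    ({ω : BondConfig (Fin n) | 1 ≤ (A.filter fun z => ω ∈ openConn o z).card ∧
        (A.filter fun z => ω ∈ openConn o z).card ≤ j} \
      {ω | ∃ b ∈ A, ω ∉ openConn o b ∧ j < (A.filter fun z => ω ∈ openConn b z).card}) ⊆
    ({ω : BondConfig (Fin n) | (A.filter fun z => ω ∈ openConn a z).card ≤ j} \
      {ω | ∃ b ∈ A, ω ∉ openConn a b ∧ j < (A.filter fun z => ω ∈ openConn b z).card}) := by
  intro ω hω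
  rw [mem_sdiff, mem_setOf_eq, mem_setOf_eq] at hω
  obtain ⟨⟨_, hle⟩, hno⟩ := hω
  push Not at hno
  refine ⟨?_, ?_⟩
  · -- `|π(a)| ≤ j`
    rw [mem_setOf_eq]
    by_cases hoa : ω ∈ openConn o a
    · rw [filter_eq_of_reachable A hoa]; exact hle
    · by_cases haA : a ∈ A
      · exact hno a haA hoa
      · -- `a ∉ A`: still every cluster other than `C(o)` is small; use the cluster of `a` via any relay in it
        by_contra hlt
        push Not at hlt
        -- some relay `b ∈ π(a)`
        have hne : (A.filter fun z => ω ∈ openConn a z).Nonempty := by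
          rw [← Finset.card_pos]; omega
        obtain ⟨b, hb⟩ := hne
        rw [Finset.mem_filter] at hb
        have hab : (openGraph ω).Reachable a b := hb.2
        have hob : ω ∉ openConn o b := by
          intro hob
          have hob' : (openGraph ω).Reachable o b := hob
          exact hoa (show (openGraph ω).Reachable o a from hob'.trans hab.symm)
        have hcard : (A.filter fun z => ω ∈ openConn b z).card =
            (A.filter fun z => ω ∈ openConn a z).card := by
          rw [filter_eq_of_reachable A (show ω ∈ openConn a b from hab)]
        have := hno b hb.1 hob
        omega
  · -- no big cluster other than `C(a)`
    rw [mem_setOf_eq]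
    rintro ⟨b, hbA, hab, hbig⟩
    by_cases hob : ω ∈ openConn o b
    · rw [filter_eq_of_reachable A hob] at hbig
      omega
    · exact absurd (hno b hbA hob) (not_le.2 hbig)

end GuardedCIL

open GuardedCIL in
/-- **GCIL ⇒ CIL, level by level, same witness.**  If for every finite weighted graph, every nonempty
relay set `A`, every observer `o ∉ A` and every level `j` some relay `a ∈ A` satisfies the guarded
inequality `P(1 ≤ N ≤ j, Big(o)) ≤ P(|π(a)| ≤ j, Big(a))`, then the (unguarded) cumulative isolation
lemma holds in the shape of `Theorems.noHeavyLowerTail_of_stub_cumulativeIsolation`. -/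
theorem cumulativeIsolation_of_guardedCIL
    (hG : ∀ (n : ℕ) (w : Sym2 (Fin n) → unitInterval) (A : Finset (Fin n)) (o : Fin n) (j : ℕ),
      A.Nonempty → o ∉ A → ∃ a ∈ A,
        (prodBernoulli w).real
            ({ω : BondConfig (Fin n) | 1 ≤ (A.filter fun z => ω ∈ openConn o z).card ∧
                (A.filter fun z => ω ∈ openConn o z).card ≤ j} ∩
              {ω | ∃ b ∈ A, ω ∉ openConn o b ∧ j < (A.filter fun z => ω ∈ openConn b z).card}) ≤
          (prodBernoulli w).real
            ({ω : BondConfig (Fin n) | (A.filter fun z => ω ∈ openConn a z).card ≤ j} ∩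
              {ω | ∃ b ∈ A, ω ∉ openConn a b ∧ j < (A.filter fun z => ω ∈ openConn b z).card}))
    (n : ℕ) (w : Sym2 (Fin n) → unitInterval) (A : Finset (Fin n)) (o : Fin n) (j : ℕ)
    (hA : A.Nonempty) (ho : o ∉ A) :
    ∃ a ∈ A,
      (Literature.Probability.LatticeModels.prodBernoulli w).real
          {ω : Literature.Probability.Percolation.BondConfig (Fin n) |
            1 ≤ (A.filter fun x => ω ∈ Literature.Probability.Percolation.openConn o x).card ∧
              (A.filter fun x => ω ∈ Literature.Probability.Percolation.openConn o x).card ≤ j} ≤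
        (Literature.Probability.LatticeModels.prodBernoulli w).real
          {ω : Literature.Probability.Percolation.BondConfig (Fin n) |
            (A.filter fun x => ω ∈ Literature.Probability.Percolation.openConn a x).card ≤ j} := by
  obtain ⟨a, ha, hle⟩ := hG n w A o j hA ho
  refine ⟨a, ha, ?_⟩
  set μ := prodBernoulli w with hμ
  set L : Set (BondConfig (Fin n)) := {ω | 1 ≤ (A.filter fun x => ω ∈ openConn o x).card ∧
    (A.filter fun x => ω ∈ openConn o x).card ≤ j} with hL
  set R : Set (BondConfig (Fin n)) := {ω | (A.filter fun x => ω ∈ openConn a x).card ≤ j} with hR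
  set Bo : Set (BondConfig (Fin n)) :=
    {ω | ∃ b ∈ A, ω ∉ openConn o b ∧ j < (A.filter fun z => ω ∈ openConn b z).card} with hBo
  set Ba : Set (BondConfig (Fin n)) :=
    {ω | ∃ b ∈ A, ω ∉ openConn a b ∧ j < (A.filter fun z => ω ∈ openConn b z).card} with hBa
  have hmeas : ∀ s : Set (BondConfig (Fin n)), MeasurableSet s := fun _ => MeasurableSet.of_discrete
  have hsplitL : μ.real L = μ.real (L ∩ Bo) + μ.real (L \ Bo) := by
    rw [← measureReal_inter_add_sdiff (hmeas Bo) (measure_ne_top _ _)]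
  have hsplitR : μ.real R = μ.real (R ∩ Ba) + μ.real (R \ Ba) := by
    rw [← measureReal_inter_add_sdiff (hmeas Ba) (measure_ne_top _ _)]
  have hdiff : μ.real (L \ Bo) ≤ μ.real (R \ Ba) :=
    measureReal_mono (small_diff_subset A o a j) (measure_ne_top _ _)
  rw [hsplitL, hsplitR]
  exact add_le_add hle hdiff

/-- **The guarded cumulative isolation lemma (all levels) closes the crux `NoHeavyLowerTail`.** -/
theorem noHeavyLowerTail_of_guardedCIL
    (hG : ∀ (n : ℕ) (w : Sym2 (Fin n) → unitInterval) (A : Finset (Fin n)) (o : Fin n) (j : ℕ),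
      A.Nonempty → o ∉ A → ∃ a ∈ A,
        (prodBernoulli w).real
            ({ω : BondConfig (Fin n) | 1 ≤ (A.filter fun z => ω ∈ openConn o z).card ∧
                (A.filter fun z => ω ∈ openConn o z).card ≤ j} ∩
              {ω | ∃ b ∈ A, ω ∉ openConn o b ∧ j < (A.filter fun z => ω ∈ openConn b z).card}) ≤
          (prodBernoulli w).real
            ({ω : BondConfig (Fin n) | (A.filter fun z => ω ∈ openConn a z).card ≤ j} ∩
              {ω | ∃ b ∈ A, ω ∉ openConn a b ∧ j < (A.filter fun z => ω ∈ openConn b z).card})) :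
    Summit.CriticalPhenomena.PercolationContinuityZ3.Theses.PercNearOneGluing.NoHeavyLowerTail :=
  noHeavyLowerTail_of_stub_cumulativeIsolation (cumulativeIsolation_of_guardedCIL hG)

end Summit.CriticalPhenomena.PercolationContinuityZ3.Theorems

end
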